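import Literature.Analysis.FluidPDE.LeraySelfSimilarCalculus
import Literature.Analysis.FluidPDE.NecasRuzickaSverakHolds
import Literature.Analysis.FluidPDE.TsaiSelfSimilarHolds
import HarnessLib

/-!
# Leray's reduction from ANY time interval below the blow-up time, and the packaged exclusion of
# exactly self-similar singularities (Leray 1934, §20; Nečas–Růžička–Šverák 1996; Tsai 1998)

Analysis/FluidPDE proof file (theorems only; no definitions, no named facts, no `sorry`). The tree's
`Literature.Analysis.FluidPDE.lerayBackward_isClassical_iff_holds` (`LeraySelfSimilarCalculus`)
identifies classical solutions of Leray's backward self-similar form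
`u(t,x) = λ(t)U(λ(t)x)`, `p(t,x) = λ(t)²P(λ(t)x)`, `λ(t) = (2a(T−t))^{-1/2}`, on the WHOLE open slab
`(−∞, T) × E` with solutions `(U, P)` of the profile system (`IsLerayProfile ν a U P`), the
forward direction being proved by evaluating at the normalised time `T − (2a)⁻¹`. A claimed
blow-up construction, however, typically exhibits such a field only on a forward interval
`(t₁, T)` (from its datum up to the singular time). Since the ansatz is EXACTLY self-similar, the
momentum equation at any single time `t < T` is `λ(t)³` times the profile equation at `y = λ(t)x`
(Leray 1934, §20, (3.11)–(3.12): "les équations de Navier se réduisent alors au système (3.11)";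
Tsai 1998, (1.1)–(1.3): "The Navier–Stokes equations for `u` give the system (1.3) for `U`"),
so the profile system follows from the equations on ANY nonempty time interval below `T`:

* `isLerayProfile_of_isClassicalNSSolutionOn` — if `(lerayBackward a T U, lerayBackwardPressure a T P)`
  is a classical unforced Navier–Stokes solution on an open time set `S` containing some `t₀ < T`
  (e.g. `S = Ioo t₁ T`), with `U`, `P` smooth and `a > 0`, then `IsLerayProfile ν a U P`.

Composed with the DISCHARGED exclusion theorems of the tree this gives the kernel TEST against
exactly self-similar blow-up claims in the form they are printed (a solution on `(t₁, T*)` with an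
explicit smooth decaying profile):

* `lerayBackward_profile_eq_zero_of_memLp_three` — profile in `L³(ℝ³)` ⇒ `U = 0`
  (Nečas–Růžička–Šverák 1996, Thm. 1; tree `necas_ruzicka_sverak_holds`);
* `lerayBackward_profile_eq_zero_of_memLp` — profile in `L^q(ℝ³)`, `3 < q < ∞` ⇒ `U = 0`
  (Tsai 1998, Thm. 1; tree `tsai_selfsimilar_holds`);
* `not_exists_selfSimilar_blowup_memLp_three` — there is NO classical solution of the unforced
  Navier–Stokes equations on `ℝ³ × (t₁, T)` of Leray's exactly self-similar form with a smooth,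
  nonzero profile `U ∈ L³(ℝ³)` (any `ν > 0`, `a > 0`, `t₁ < T`).

Catalogue context: `Literature.Barriers.NavierStokesRegularity.LeraySelfSimilarBlowupExclusion`
(all conjuncts proved). Cell `ns-claims` (D-0090), claim C12: the reconstruction step
"`Ω = (T*−t)⁻¹Ω̄(r/√(T*−t), z/√(T*−t))` induces `u(x,t) = (T*−t)^{-1/2} ū(x/√(T*−t))`" is the
case `a = 1/2` of `lerayBackward`.

## References

* J. Leray, Acta Math. 63 (1934), §20, (3.11)–(3.12), p. 225. [Leray1934]
* J. Nečas, M. Růžička, V. Šverák, Acta Math. 176 (1996) 283–294, Thm. 1 (p. 291).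
  [NecasRuzickaSverak1996]
* T.-P. Tsai, Arch. Rational Mech. Anal. 143 (1998) 29–51, (1.1)–(1.3), Thm. 1. [Tsai1998]
-/

noncomputable section

open Set Function Filter Topology InnerProductSpace MeasureTheory
open scoped Laplacian RealInnerProductSpace ContDiff ENNReal

namespace Literature.Analysis.FluidPDE

section AnyInterval

variable {E : Type*} [NormedAddCommGroup E] [InnerProductSpace ℝ E] [FiniteDimensional ℝ E]
variable {a T ν : ℝ} {U : E → E} {P : E → ℝ} {S : Set ℝ}

/-- **Leray's reduction from any time below the blow-up time** (Leray 1934, §20, (3.11)–(3.12);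
Tsai 1998, (1.1)–(1.3)). Let `a > 0`, `U`, `P` smooth, and suppose Leray's backward ansatz
`(lerayBackward a T U, lerayBackwardPressure a T P)` is a classical solution of the unforced
Navier–Stokes equations with viscosity `ν` on a time set `S` having an interior point `t₀ < T`.
Then `(U, P)` solves the profile system `−νΔU + aU + a(y·∇)U + (U·∇)U + ∇P = 0`, `div U = 0`.
Proof: at `(t₀, x)` every term of the momentum equation equals `λ(t₀)³` times the corresponding
profile term at `y = λ(t₀)x` (`timeDeriv_lerayBackward`, `convect_lerayBackward`,
`laplacian_lerayBackward`, `gradient_lerayBackwardPressure_sub`), `λ(t₀) > 0`, and `x ↦ λ(t₀)x`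
is onto. [cite: Leray1934, §20 (3.11)–(3.12) p. 225] -/
theorem isLerayProfile_of_isClassicalNSSolutionOn (ha : 0 < a) (hU : ContDiff ℝ ∞ U)
    (hP : ContDiff ℝ ∞ P) {t₀ : ℝ} (ht₀ : t₀ < T) (ht₀S : t₀ ∈ interior S)
    (h : IsClassicalNSSolutionOn S ν 0 (lerayBackward a T U) (lerayBackwardPressure a T P)) :
    IsLerayProfile ν a U P := by
  have hU1 : ContDiff ℝ 1 U := hU.of_le (by norm_cast)
  have hU2 : ContDiff ℝ 2 U := hU.of_le (by norm_cast)
  have hmemS : t₀ ∈ S := interior_subset ht₀S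
  set L : ℝ := (Real.sqrt (2 * a * (T - t₀)))⁻¹ with hL
  have hLpos : 0 < L := lerayScale_pos ha ht₀
  have hL3 : L ^ 3 ≠ 0 := pow_ne_zero 3 hLpos.ne'
  refine ⟨hU2, hP.of_le (by norm_cast), fun y => ?_, fun y => ?_⟩
  · -- momentum at `(t₀, L⁻¹ y)`
    set x : E := L⁻¹ • y with hx
    have hyx : L • x = y := by rw [hx, smul_smul, mul_inv_cancel₀ hLpos.ne', one_smul]
    have hm := h.momentum t₀ hmemS x
    rw [timeDerivWithin_of_mem_interior ht₀S x, timeDeriv_lerayBackward ha ht₀ hU1 x,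
      convect_lerayBackward, laplacian_lerayBackward hU2, lerayBackwardPressure_eq_of_lt ha ht₀ P,
      gradient_lerayBackwardPressure_sub] at hm
    simp only [← hL, hyx, Pi.zero_apply, add_zero] at hm
    -- `hm : (a L³) • (U y + DU y y) + L³ • (U·∇)U y = ν • L³ • ΔU y − L³ • ∇P y`
    have hm' : L ^ 3 • (a • U y + a • fderiv ℝ U y y + convect U U y) =
        L ^ 3 • (ν • (Δ U) y - gradient P y) := by
      have e1 : (a * L ^ 3) • (U y + fderiv ℝ U y y) + L ^ 3 • convect U U y =
          L ^ 3 • (a • U y + a • fderiv ℝ U y y + convect U U y) := by module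
      have e2 : ν • L ^ 3 • (Δ U) y - L ^ 3 • gradient P y = L ^ 3 • (ν • (Δ U) y - gradient P y) := by
        rw [smul_comm ν (L ^ 3), smul_sub]
      rw [← e1, ← e2]
      exact hm
    have hm'' : a • U y + a • fderiv ℝ U y y + convect U U y = ν • (Δ U) y - gradient P y :=
      smul_right_injective E hL3 hm'
    calc -(ν • (Δ U) y) + a • U y + a • fderiv ℝ U y y + convect U U y + gradient P y
        = (a • U y + a • fderiv ℝ U y y + convect U U y) - (ν • (Δ U) y - gradient P y) := by abel
      _ = 0 := by rw [hm'', sub_self]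
  · -- incompressibility at `(t₀, L⁻¹ y)`
    set x : E := L⁻¹ • y with hx
    have hyx : L • x = y := by rw [hx, smul_smul, mul_inv_cancel₀ hLpos.ne', one_smul]
    have hd := h.divFree t₀ hmemS x
    rw [divergence_lerayBackward, ← hL, hyx] at hd
    rcases mul_eq_zero.1 hd with h2 | h2
    · exact absurd h2 (pow_ne_zero 2 hLpos.ne')
    · exact h2

/-- The forward-interval form: a classical solution of Leray's exactly self-similar form on
`(t₁, T) × E`, `t₁ < T`, has a profile solving Leray's system. [cite: Leray1934, §20 (3.11)–(3.12) p. 225] -/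
theorem isLerayProfile_of_isClassicalNSSolutionOn_Ioo (ha : 0 < a) (hU : ContDiff ℝ ∞ U)
    (hP : ContDiff ℝ ∞ P) {t₁ : ℝ} (ht₁ : t₁ < T)
    (h : IsClassicalNSSolutionOn (Ioo t₁ T) ν 0 (lerayBackward a T U) (lerayBackwardPressure a T P)) :
    IsLerayProfile ν a U P := by
  have hmid : (t₁ + T) / 2 ∈ Ioo t₁ T := ⟨by linarith, by linarith⟩
  exact isLerayProfile_of_isClassicalNSSolutionOn ha hU hP hmid.2
    (by rwa [interior_Ioo]) h

end AnyInterval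

/-! ### `ℝ³`: the packaged exclusion tests -/

section R3

variable {a T ν : ℝ} {U : EuclideanSpace ℝ (Fin 3) → EuclideanSpace ℝ (Fin 3)}
  {P : EuclideanSpace ℝ (Fin 3) → ℝ}

/-- **No exactly self-similar singularity with an `L³` profile, forward-interval form**
(Nečas–Růžička–Šverák 1996, Thm. 1, through `necas_ruzicka_sverak_holds`): if Leray's backward
ansatz with smooth profile `(U, P)`, `a > 0`, solves the unforced Navier–Stokes equations with
`ν > 0` classically on `(t₁, T) × ℝ³` for some `t₁ < T`, and `U ∈ L³(ℝ³)`, then `U = 0` (the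
"blow-up" is the rest state). [cite: NecasRuzickaSverak1996, Thm. 1 (p. 291)] -/
theorem lerayBackward_profile_eq_zero_of_memLp_three (hν : 0 < ν) (ha : 0 < a)
    (hU : ContDiff ℝ ∞ U) (hP : ContDiff ℝ ∞ P) {t₁ : ℝ} (ht₁ : t₁ < T)
    (h : IsClassicalNSSolutionOn (Ioo t₁ T) ν 0 (lerayBackward a T U) (lerayBackwardPressure a T P))
    (hL3 : MemLp U 3) : U = 0 :=
  necas_ruzicka_sverak_holds hν ha (isLerayProfile_of_isClassicalNSSolutionOn_Ioo ha hU hP ht₁ h) hL3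

/-- **No exactly self-similar singularity with an `L^q` profile, `3 < q < ∞`, forward-interval
form** (Tsai 1998, Thm. 1, through `tsai_selfsimilar_holds`). [cite: Tsai1998, Thm. 1] -/
theorem lerayBackward_profile_eq_zero_of_memLp (hν : 0 < ν) (ha : 0 < a)
    (hU : ContDiff ℝ ∞ U) (hP : ContDiff ℝ ∞ P) {t₁ : ℝ} (ht₁ : t₁ < T)
    (h : IsClassicalNSSolutionOn (Ioo t₁ T) ν 0 (lerayBackward a T U) (lerayBackwardPressure a T P))
    {q : ℝ≥0∞} (hq : 3 < q) (hq' : q < ⊤) (hLq : MemLp U q) : U = 0 :=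
  tsai_selfsimilar_holds hν ha (isLerayProfile_of_isClassicalNSSolutionOn_Ioo ha hU hP ht₁ h) hq hq' hLq

/-- **The kernel test against exactly self-similar blow-up claims**: for no `ν > 0`, `a > 0`,
`t₁ < T` and no smooth profile pair `(U, P)` with `U ∈ L³(ℝ³)`, `U ≠ 0`, is Leray's backward
self-similar field a classical solution of the unforced Navier–Stokes equations on
`(t₁, T) × ℝ³`. A claimed construction "`u(x,t) = (2a(T−t))^{-1/2} U(x/√(2a(T−t)))` solves the
equations up to the singular time `T` with a nontrivial rapidly decaying profile" is an instance
of the negated statement. [cite: NecasRuzickaSverak1996, Thm. 1 (p. 291)] -/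
theorem not_exists_selfSimilar_blowup_memLp_three :
    ¬ ∃ (ν a T t₁ : ℝ) (U : EuclideanSpace ℝ (Fin 3) → EuclideanSpace ℝ (Fin 3))
        (P : EuclideanSpace ℝ (Fin 3) → ℝ),
        0 < ν ∧ 0 < a ∧ t₁ < T ∧ ContDiff ℝ ∞ U ∧ ContDiff ℝ ∞ P ∧ MemLp U 3 ∧ U ≠ 0 ∧
          IsClassicalNSSolutionOn (Ioo t₁ T) ν 0 (lerayBackward a T U) (lerayBackwardPressure a T P) := by
  rintro ⟨ν, a, T, t₁, U, P, hν, ha, ht₁, hU, hP, hL3, hne, h⟩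
  exact hne (lerayBackward_profile_eq_zero_of_memLp_three hν ha hU hP ht₁ h hL3)

end R3

end Literature.Analysis.FluidPDE

end
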